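import Literature.AlgebraicGeometry.Frobenioids.ArchimedeanIsotropy
import HarnessLib

/-!
# Frobenioids II, Example 3.3 (iii): co-angularity in `A` versus `C` — PROOF

Mochizuki, *The geometry of Frobenioids II: poly-Frobenioids*, Kyushu J. Math. **62** (2008)
401–460, §3, Example 3.3 (iii), author's text p. 29 [cite: MochizukiFrdII2008, Ex 3.3 (iii) p.29]:
"a morphism of `A` is co-angular (as a morphism of `A`!) if and only if it is co-angular as a morphism
of `C`".

PROVED here (`Ex33iii_coAngular_iff_holds`). Key point: `Φ₀ = ℝ_{≥0}` is sharp — `Div ≥ 0` with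
`Div(ψ ≫ φ) = Div(φ) + deg_Fr(φ)·Div(ψ)` — so every factor of an isometry of `C` is an isometry
(`C0.isIsometry_of_comp`); hence a factorisation in `C` of an arrow of `A` IS a factorisation in `A`,
while conversely factorisations in `A` are factorisations in `C` whose middle isomorphism (an
isometry, with isometric inverse) lifts back to `A`.
-/

namespace Literature.AlgebraicGeometry.Frobenioids

open CategoryTheory Opposite
open scoped NNReal

noncomputable section

namespace ArchFrd

/-- `Φ₀ = ℝ_{≥0}` is sharp: if a composite `ψ ≫ φ` of `C₀` is an isometry, so are `ψ` and `φ`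
(`ratio(ψ ≫ φ) = ratio(φ) · ratio(ψ)^{deg_Fr φ}` with all ratios `≥ 1`).
[cite: MochizukiFrdII2008, Ex 3.3 (i) p.28] -/
theorem C0.isIsometry_of_comp {X Y Z : C0} (ψ : X ⟶ Y) (φ : Y ⟶ Z)
    (h : PreFrobenioid.IsIsometry C0.toElem (ψ ≫ φ)) :
    PreFrobenioid.IsIsometry C0.toElem ψ ∧ PreFrobenioid.IsIsometry C0.toElem φ := by
  rw [A0.isIsometry_iff_ratio_eq_one, C0.ratio_comp] at h
  rw [A0.isIsometry_iff_ratio_eq_one, A0.isIsometry_iff_ratio_eq_one]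
  have h1 := C0.one_le_ratio φ
  have h2 := C0.one_le_ratio ψ
  have hpow : 1 ≤ C0.ratio ψ ^ (C0.degFr φ : ℕ) := one_le_pow₀ h2
  have hφ : C0.ratio φ = 1 :=
    le_antisymm (by nlinarith [mul_le_mul_of_nonneg_left hpow (zero_le_one.trans h1)]) h1
  refine ⟨?_, hφ⟩
  rw [hφ, one_mul] at h
  exact (pow_eq_one_iff_of_nonneg (zero_le_one.trans h2) (C0.degFr φ).ne_zero).mp h

universe v u

variable {D : Type u} [Category.{v} D] (π : D ⥤ D0)

/-- **Example 3.3 (iii)**: an arrow of `A` is co-angular in `A` iff it is co-angular in `C` — PROVED.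
[cite: MochizukiFrdII2008, Ex 3.3 (iii) p.29] -/
theorem Ex33iii_coAngular_iff_holds : Ex33iii_coAngular_iff π := by
  intro X Y φ
  constructor
  · -- co-angular in `A` ⇒ co-angular in `C`: all factors of the isometry `φ` are isometries
    intro hA P Q γ β α hfac hlin _ hpre hbi
    have h3 : PreFrobenioid.IsIsometry (C.toElem π) (γ ≫ β ≫ α) := by
      rw [hfac]; exact φ.property
    obtain ⟨hγ, hβα⟩ := C0.isIsometry_of_comp γ.fst (β.fst ≫ α.fst) h3
    obtain ⟨hβ, hα⟩ := C0.isIsometry_of_comp β.fst α.fst hβα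
    let P' : A π := ⟨P⟩
    let Q' : A π := ⟨Q⟩
    let γ' : X ⟶ P' := ⟨γ, hγ⟩
    let β' : P' ⟶ Q' := ⟨β, hβ⟩
    let α' : Q' ⟶ Y := ⟨α, hα⟩
    have hfac' : γ' ≫ β' ≫ α' = φ := WideSubcategory.hom_ext _ hfac
    haveI : IsIso β' := hA γ' β' α' hfac' hlin (Subsingleton.elim _ _) hpre hbi
    exact (inferInstance : IsIso ((A.ι π).map β'))
  · -- co-angular in `C` ⇒ co-angular in `A`: invert the middle arrow inside `A`
    intro hC P Q γ β α hfac hlin _ hpre hbi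
    have hfacC : γ.hom ≫ β.hom ≫ α.hom = φ.hom := congrArg InducedWideCategory.Hom.hom hfac
    haveI : IsIso β.hom := hC γ.hom β.hom α.hom hfacC hlin β.property hpre hbi
    refine ⟨⟨⟨inv β.hom, C.isIsometry_inv π β.hom⟩, ?_, ?_⟩⟩
    · exact WideSubcategory.hom_ext _ (IsIso.hom_inv_id β.hom)
    · exact WideSubcategory.hom_ext _ (IsIso.inv_hom_id β.hom)

end ArchFrd

end

end Literature.AlgebraicGeometry.Frobenioids
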